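import Mathlib
import HarnessLib

/-!
# Crux `Steer` (stmt-ResolutionOfSingularities-16345), line `switching_dichotomy`, card `singular-trace-constructor`:
# the DERIVATION CRITERION, Stage A — TAYLOR DECOMPOSITION `S = ⊕_{i<p} R · (i!⁻¹ y^i)` for a derivation `D` with `D(S) ⊆ S`,
# `D y = 1` and `D^p = 0` on `S`, where `R = S ∩ ker D`

OURS (campaign `res-hironaka`, rung L ★L-G4, slot W4.1, chain W4.1; seat `res-type-083` g8 on res-L0-w41-strat-1 g6's CONSULT
2026-08-27T11:48:57Z (3) «DERIVATION CRITERION `exitAt_of_derivation_unit`», KN-free direction of the card; TAKING 11:57:16Z, staged (A)/(B)/(C);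
Theses-free, definition-free helper `--supports stmt-ResolutionOfSingularities-16345`; replaces the role of no printed item; NOT a statement
of the manuscript under review [claim: Hironaka2017, status: under-review]; AI-produced, weaker than expert review).

THE SETTING (object-free, as in `…FrobeniusClosingSteerSandwichModel`). `K` a field of characteristic `p`, `S ≤ K` a subring containing the
image of `k`, `D : Derivation k K K` with `D(S) ⊆ S`, `y ∈ S` with `D y = 1`, `D^p = 0` on `S` (hypothesis `hDp` — discharged from the
field situation `K = Frac A₀(t)`, `D|_{A₀} = 0` in Stage B), and the CONSTANTS `R` given by a membership clause
`hR : ∀ x, x ∈ R ↔ x ∈ S ∧ D x = 0` (no new definition). With the divided powers `e i := i!⁻¹ · y^i` (`i < p`):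
* `pow_apply_dividedPower` — `D^n (e m) = e (m - n)` for `n ≤ m < p`, `= 0` for `m < n`;
* `exists_coeffs` — **existence**: every `s ∈ S` is `Σ_{i<p} r_i · e i` with `r_i ∈ R` (induction on the nilpotency index: the top
  coefficient `D^n s` is a constant; strat-1's Taylor projector in recursive form);
* `coeffs_unique` — **uniqueness**: `Σ_{i<n} r_i · e i = 0` with constants `r_i`, `n ≤ p` ⇒ all `r_i = 0` (apply `D^{n-1}`);
* `exists_eq_pow_mul_of_mul_mem` — **`R ∩ y·S = y^p·R`**; `pow_char_mem` — `S^p ⊆ R`; `apply_inv_eq_zero` — constants invert to constants.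
Stage C (`…DerivationExit`) turns these into: `R` local Noetherian, `R/(y^p) ≅ S/(y)`, `R` regular with `y^p ∈ 𝔪_R ∖ 𝔪_R²`
(tree `RegularLocalRingsQuotient`), `GenAt R p t y ∧ OrderOneGen R p y`, i.e. `ExitAt R p t`. Source of the argument: res-L0-w41-strat-1's
sketch (Miyanishi–Ito Ch. 1 lemma on reduced p-closed derivations, assertion (4), elementary Taylor direction). [folklore]
-/

-- `Summit.<S>.<S>.…` duplicates the summit name by design (single-problem summit).
set_option linter.dupNamespace false

open scoped Nat

namespace Summit.ResolutionOfSingularities.ResolutionOfSingularities.Theorems.SwitchingDichotomy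

namespace DerivationExit

variable {k K : Type} [Field k] [Field K] [Algebra k K]

/-! ## Iterates of a derivation against its constants -/

/-- A derivation is linear over its constants. [folklore] -/
theorem apply_mul_of_apply_eq_zero (D : Derivation k K K) {r : K} (hr : D r = 0) (x : K) : D (r * x) = r * D x := by
  rw [Derivation.leibniz, hr, smul_zero, add_zero, smul_eq_mul]

/-- Iterates of a derivation are linear over its constants. [folklore] -/
theorem pow_apply_mul_of_apply_eq_zero (D : Derivation k K K) {r : K} (hr : D r = 0) (n : ℕ) (x : K) :
    ((D : K →ₗ[k] K) ^ n) (r * x) = r * ((D : K →ₗ[k] K) ^ n) x := by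
  induction n generalizing x with
  | zero => simp
  | succ n ih =>
    rw [pow_succ', Module.End.mul_apply, Module.End.mul_apply, ih, Derivation.coeFn_coe,
      apply_mul_of_apply_eq_zero D hr]

/-- The inverse of a non-zero constant is a constant. [folklore] -/
theorem apply_inv_eq_zero (D : Derivation k K K) {r : K} (hr : D r = 0) : D r⁻¹ = 0 := by
  rw [Derivation.leibniz_inv, hr, smul_zero]

/-- Inverses of natural numbers are constants. [folklore] -/
theorem apply_inv_natCast (D : Derivation k K K) (n : ℕ) : D ((n : K)⁻¹) = 0 :=
  apply_inv_eq_zero D (D.map_natCast n)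

/-! ## The divided powers `e m := (m !)⁻¹ · y ^ m` of an element with `D y = 1` -/

section DividedPowers

variable (p : ℕ) [Fact p.Prime] [CharP K p] (D : Derivation k K K) {y : K} (hy : D y = 1)

include hy in
/-- `D (y ^ (m+1)) = (m+1) · y ^ m`. [folklore] -/
theorem apply_pow_succ (m : ℕ) : D (y ^ (m + 1)) = ((m + 1 : ℕ) : K) * y ^ m := by
  rw [Derivation.leibniz_pow, hy, smul_eq_mul, mul_one, Nat.add_sub_cancel, nsmul_eq_mul]

omit [Fact p.Prime] in
include hy in
/-- `D` lowers the divided powers: `D ((m+1)!⁻¹ y^(m+1)) = m!⁻¹ y^m` for `m + 1 < p`. [folklore] -/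
theorem apply_dividedPower_succ {m : ℕ} (hm : m + 1 < p) :
    D ((((m + 1) ! : ℕ) : K)⁻¹ * y ^ (m + 1)) = (((m ! : ℕ) : K))⁻¹ * y ^ m := by
  have hm1 : ((m + 1 : ℕ) : K) ≠ 0 := by
    intro h
    rw [CharP.cast_eq_zero_iff K p] at h
    exact absurd (Nat.le_of_dvd (Nat.succ_pos m) h) (not_le.mpr hm)
  rw [apply_mul_of_apply_eq_zero D (apply_inv_natCast D _), apply_pow_succ D hy, Nat.factorial_succ, Nat.cast_mul,
    mul_inv]
  field_simp

omit [Fact p.Prime] in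
include hy in
/-- ITERATES ON DIVIDED POWERS: `D^n (m!⁻¹ y^m) = (m-n)!⁻¹ y^(m-n)` for `n ≤ m < p`, and `= 0` for `m < n`. [folklore] -/
theorem pow_apply_dividedPower {m : ℕ} (hm : m < p) (n : ℕ) :
    ((D : K →ₗ[k] K) ^ n) ((((m ! : ℕ) : K))⁻¹ * y ^ m) =
      if n ≤ m then (((m - n) ! : ℕ) : K)⁻¹ * y ^ (m - n) else 0 := by
  induction n generalizing m with
  | zero => simp
  | succ n ih =>
    rcases m with _ | m
    · -- `m = 0`: `D (0!⁻¹ * y^0) = D 1 = 0`, then iterate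
      rw [pow_succ, Module.End.mul_apply, Derivation.coeFn_coe]
      simp
    · rw [pow_succ, Module.End.mul_apply, Derivation.coeFn_coe, apply_dividedPower_succ p D hy hm, ih (by omega)]
      by_cases hnm : n ≤ m
      · rw [if_pos hnm, if_pos (by omega), Nat.succ_sub_succ]
      · rw [if_neg hnm, if_neg (by omega)]

end DividedPowers

/-! ## Taylor decomposition `S = ⊕_{i<p} R · (i!⁻¹ y^i)` for a derivation with `D y = 1`, `D^p = 0` on `S` -/

section Taylor

variable (p : ℕ) [Fact p.Prime] [CharP K p] (S : Subring K) (D : Derivation k K K)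
  (hDS : ∀ s ∈ S, D s ∈ S) (hkS : ∀ c : k, algebraMap k K c ∈ S) {y : K} (hyS : y ∈ S) (hy : D y = 1)
  (hDp : ∀ s ∈ S, ((D : K →ₗ[k] K) ^ p) s = 0)
  (R : Subring K) (hR : ∀ x, x ∈ R ↔ x ∈ S ∧ D x = 0)

include hDS in
/-- Iterates stay in `S`. [folklore] -/
theorem pow_apply_mem (n : ℕ) {s : K} (hs : s ∈ S) : ((D : K →ₗ[k] K) ^ n) s ∈ S := by
  induction n with
  | zero => simpa
  | succ n ih => rw [pow_succ', Module.End.mul_apply, Derivation.coeFn_coe]; exact hDS _ ih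

include hkS in
/-- `(n : K)⁻¹ ∈ S` (the image of `k` lies in `S`). [folklore] -/
theorem inv_natCast_mem (n : ℕ) : ((n : K))⁻¹ ∈ S := by
  have : ((n : K))⁻¹ = algebraMap k K ((n : k))⁻¹ := by rw [map_inv₀, map_natCast]
  rw [this]; exact hkS _

include hkS hyS in
/-- The divided powers lie in `S`. [folklore] -/
theorem dividedPower_mem (m : ℕ) : (((m ! : ℕ) : K))⁻¹ * y ^ m ∈ S :=
  S.mul_mem (inv_natCast_mem S hkS _) (S.pow_mem hyS m)

omit [Fact p.Prime] in
include hDS hkS hyS hy hR in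
/-- **EXISTENCE of the Taylor coefficients** (induction on the nilpotency index): every `s ∈ S` with `D^n s = 0`, `n ≤ p`, is
`Σ_{i<n} r_i · (i!⁻¹ y^i)` with `r_i ∈ R`. [folklore] -/
theorem exists_coeffs_of_pow_apply_eq_zero (n : ℕ) (hn : n ≤ p) :
    ∀ s ∈ S, ((D : K →ₗ[k] K) ^ n) s = 0 →
      ∃ r : ℕ → K, (∀ i, r i ∈ R) ∧ s = ∑ i ∈ Finset.range n, r i * ((((i ! : ℕ) : K))⁻¹ * y ^ i) := by
  induction n with
  | zero =>
    intro s _ hs0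
    refine ⟨fun _ => 0, fun _ => (hR 0).mpr ⟨S.zero_mem, map_zero D⟩, ?_⟩
    simpa using hs0
  | succ n ih =>
    intro s hs hs0
    -- the top coefficient `c := D^n s` is a constant
    set c := ((D : K →ₗ[k] K) ^ n) s with hc
    have hcS : c ∈ S := pow_apply_mem S D hDS n hs
    have hDc : D c = 0 := by
      have := hs0
      rwa [pow_succ', Module.End.mul_apply, Derivation.coeFn_coe] at this
    have hcR : c ∈ R := (hR c).mpr ⟨hcS, hDc⟩
    have hnp : n < p := by omega
    -- subtract `c · (n!⁻¹ y^n)` and recurse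
    set s' := s - c * ((((n ! : ℕ) : K))⁻¹ * y ^ n) with hs'
    have hs'S : s' ∈ S := S.sub_mem hs (S.mul_mem hcS (dividedPower_mem S hkS hyS n))
    have hs'0 : ((D : K →ₗ[k] K) ^ n) s' = 0 := by
      rw [hs', map_sub, pow_apply_mul_of_apply_eq_zero D hDc, pow_apply_dividedPower p D hy hnp, if_pos le_rfl,
        Nat.sub_self, Nat.factorial_zero, Nat.cast_one, inv_one, pow_zero, mul_one, mul_one, ← hc, sub_self]
    obtain ⟨r, hr, hsum⟩ := ih (by omega) s' hs'S hs'0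
    refine ⟨Function.update r n c, fun i => ?_, ?_⟩
    · rcases eq_or_ne i n with rfl | hne
      · rw [Function.update_self]; exact hcR
      · rw [Function.update_of_ne hne]; exact hr i
    · rw [Finset.sum_range_succ, Function.update_self, Finset.sum_congr rfl fun i hi =>
        by rw [Function.update_of_ne (Finset.mem_range.mp hi).ne], ← hsum, hs', sub_add_cancel]

omit [Fact p.Prime] in
include hDS hkS hyS hy hDp hR in
/-- **The Taylor decomposition**: every `s ∈ S` is `Σ_{i<p} r_i · (i!⁻¹ y^i)` with `r_i ∈ R`. [folklore] -/
theorem exists_coeffs {s : K} (hs : s ∈ S) :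
    ∃ r : ℕ → K, (∀ i, r i ∈ R) ∧ s = ∑ i ∈ Finset.range p, r i * ((((i ! : ℕ) : K))⁻¹ * y ^ i) :=
  exists_coeffs_of_pow_apply_eq_zero p S D hDS hkS hyS hy R hR p le_rfl s hs (hDp s hs)

omit [Fact p.Prime] in
include hy hR in
/-- **UNIQUENESS of the Taylor coefficients**: if `Σ_{i<n} r_i · (i!⁻¹ y^i) = 0` with constants `r_i`, `n ≤ p`, then all `r_i = 0`
(apply `D^(n-1)` and descend). [folklore] -/
theorem coeffs_unique (n : ℕ) (hn : n ≤ p) :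
    ∀ r : ℕ → K, (∀ i < n, r i ∈ R) → ∑ i ∈ Finset.range n, r i * ((((i ! : ℕ) : K))⁻¹ * y ^ i) = 0 → ∀ i < n, r i = 0 := by
  induction n with
  | zero => intro r _ _ i hi; exact absurd hi (Nat.not_lt_zero i)
  | succ n ih =>
    intro r hr hsum
    -- apply `D^n`: only the top term survives
    have htop : r n = 0 := by
      have h := congrArg ((D : K →ₗ[k] K) ^ n) hsum
      rw [map_zero, map_sum] at h
      rw [Finset.sum_eq_single_of_mem n (Finset.self_mem_range_succ n) (fun i hi hin => ?_)] at h
      · rwa [pow_apply_mul_of_apply_eq_zero D ((hR _).mp (hr n (Nat.lt_succ_self n))).2,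
          pow_apply_dividedPower p D hy (by omega), if_pos le_rfl, Nat.sub_self, Nat.factorial_zero, Nat.cast_one,
          inv_one, pow_zero, mul_one, mul_one] at h
      · have hi' : i < n := lt_of_le_of_ne (Nat.lt_succ_iff.mp (Finset.mem_range.mp hi)) hin
        rw [pow_apply_mul_of_apply_eq_zero D ((hR _).mp (hr i (Finset.mem_range.mp hi))).2,
          pow_apply_dividedPower p D hy (by omega), if_neg (not_le.mpr hi'), mul_zero]
    intro i hi
    rcases Nat.lt_succ_iff_lt_or_eq.mp hi with hi' | rfl
    · refine ih (by omega) r (fun j hj => hr j (Nat.lt_succ_of_lt hj)) ?_ i hi'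
      rw [Finset.sum_range_succ, htop, zero_mul, add_zero] at hsum
      exact hsum
    · exact htop

omit [Fact p.Prime] in
include hy in
/-- `y ^ p` is a constant (`D (y^p) = p · y^(p-1) = 0`). [folklore] -/
theorem apply_pow_char_eq_zero : D (y ^ p) = 0 := by
  rw [Derivation.leibniz_pow, hy, smul_eq_mul, mul_one, nsmul_eq_mul, CharP.cast_eq_zero, zero_mul]

omit [Fact p.Prime] in
/-- `D (s ^ p) = 0` for every `s` (characteristic `p`). [folklore] -/
theorem apply_pow_char_eq_zero' (s : K) : D (s ^ p) = 0 := by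
  rw [Derivation.leibniz_pow, nsmul_eq_mul, CharP.cast_eq_zero, zero_mul]

omit [Fact p.Prime] in
include hR in
/-- `s ^ p ∈ R` for every `s ∈ S`. [folklore] -/
theorem pow_char_mem {s : K} (hs : s ∈ S) : s ^ p ∈ R :=
  (hR _).mpr ⟨S.pow_mem hs p, apply_pow_char_eq_zero' p D s⟩

include hDS hkS hyS hy hDp hR in
/-- **`R ∩ y·S = y^p·R`**: a multiple `y·s` (`s ∈ S`) that is a constant is a multiple of `y ^ p` by a constant. [folklore] -/
theorem exists_eq_pow_mul_of_mul_mem {s : K} (hs : s ∈ S) (hys : y * s ∈ R) : ∃ r ∈ R, y * s = y ^ p * r := by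
  have hp : p.Prime := Fact.out
  obtain ⟨r, hr, hsum⟩ := exists_coeffs p S D hDS hkS hyS hy hDp R hR hs
  obtain ⟨q, hq⟩ : ∃ q, p = q + 1 := ⟨p - 1, (Nat.sub_add_cancel hp.one_le).symm⟩
  set e : ℕ → K := fun i => (((i ! : ℕ) : K))⁻¹ * y ^ i with he
  -- the top term of `y * s`
  set T : K := y ^ p * ((((q ! : ℕ) : K))⁻¹ * r q) with hT
  have hqR : (((q ! : ℕ) : K))⁻¹ * r q ∈ R :=
    R.mul_mem ((hR _).mpr ⟨inv_natCast_mem S hkS _, apply_inv_natCast D _⟩) (hr q)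
  have hTR : T ∈ R := R.mul_mem ((hR _).mpr ⟨S.pow_mem hyS p, apply_pow_char_eq_zero p D hy⟩) hqR
  refine ⟨(((q ! : ℕ) : K))⁻¹ * r q, hqR, ?_⟩
  -- the coefficients of the Taylor expansion of `0 = (T - y s) + Σ_{1 ≤ j ≤ q} j · r (j-1) · e j`
  let c : ℕ → K := fun j => if j = 0 then T - y * s else (j : K) * r (j - 1)
  have hcR : ∀ j < p, c j ∈ R := by
    intro j _
    by_cases hj : j = 0
    · simp only [c, hj, if_true]; exact R.sub_mem hTR hys
    · simp only [c, hj, if_false]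
      exact R.mul_mem ((hR _).mpr ⟨natCast_mem S j, D.map_natCast j⟩) (hr (j - 1))
  -- `y * s` expanded
  have h1 : y * s = ∑ i ∈ Finset.range q, r i * (e i * y) + r q * (e q * y) := by
    rw [← Finset.sum_range_succ, ← hq, hsum, Finset.mul_sum]
    exact Finset.sum_congr rfl fun i _ => by ring
  have h2 : ∀ i ∈ Finset.range q, c (i + 1) * e (i + 1) = r i * (e i * y) := by
    intro i hi
    have hi1 : ((i + 1 : ℕ) : K) ≠ 0 := by
      intro h
      rw [CharP.cast_eq_zero_iff K p] at h
      have := Nat.le_of_dvd (Nat.succ_pos i) h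
      have := Finset.mem_range.mp hi
      omega
    have h : ((i + 1 : ℕ) : K) * ((((i + 1) ! : ℕ) : K))⁻¹ = (((i ! : ℕ) : K))⁻¹ := by
      rw [Nat.factorial_succ, Nat.cast_mul, mul_inv, ← mul_assoc, mul_inv_cancel₀ hi1, one_mul]
    have hc : c (i + 1) = ((i + 1 : ℕ) : K) * r i := by
      simp only [c, Nat.succ_ne_zero, if_false, Nat.add_sub_cancel]
    have he1 : e (i + 1) = ((((i + 1) ! : ℕ) : K))⁻¹ * y ^ (i + 1) := rfl
    have he0 : e i = (((i ! : ℕ) : K))⁻¹ * y ^ i := rfl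
    rw [hc, he1, he0]
    calc ((i + 1 : ℕ) : K) * r i * (((((i + 1) ! : ℕ) : K))⁻¹ * y ^ (i + 1))
        = r i * ((((i + 1 : ℕ) : K) * ((((i + 1) ! : ℕ) : K))⁻¹) * y ^ (i + 1)) := by ring
      _ = r i * ((((i ! : ℕ) : K))⁻¹ * y ^ i * y) := by rw [h, pow_succ]; ring
  have h3 : r q * (e q * y) = T := by
    simp only [hT, he]
    rw [hq, pow_succ]
    ring
  have hident : ∑ j ∈ Finset.range p, c j * e j = 0 := by
    rw [hq, Finset.sum_range_succ', Finset.sum_congr rfl h2]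
    have h0 : c 0 * e 0 = T - y * s := by simp [c, he]
    rw [h0, h1, h3]
    ring
  have hc0 := coeffs_unique p S D hy R hR p le_rfl c hcR hident 0 hp.pos
  simp only [c, if_true] at hc0
  rw [hT] at hc0
  linear_combination -hc0

end Taylor

end DerivationExit

end Summit.ResolutionOfSingularities.ResolutionOfSingularities.Theorems.SwitchingDichotomy
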